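import Summits.QuantumFields.BalabanUV.Beta.FP.TowerHLinkRowsLower
import Summits.QuantumFields.BalabanUV.Beta.NVertexLamWeightLadder

/-!
# `BalabanUV.Beta.FP.TowerHLinkRows` — road «FP», binder row D1, ROUTE T (β1): **THE END WRAPPER's STOREY DATA INSTANTIATED BELOW THE TOP AND ITS ROWS
# `hκ ∕ hκn ∕ hbl ∕ hbtop ∕ hcf ∕ hlink` DISCHARGED** — `κ k := Π_{k≤i≤n} stepScale (n−i)·#B`, `w k := −c·(Lc⁴)^{n+2} ∕ Π_{k≤i≤n} (stepScale (n−i)·Lc⁴·stepScale (n−i)·#B)`,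
# `cf k := δ` and `hb k v :=` the root-bond embedding of the slot-periodised transported response `λ̂′ᴿ_k(v)` for `k ≤ n` (an2 W-3), `cf (n+1) := cfTop`, `hb (n+1) := hv`;
# `hlink` = an2 PART 18 `periodised_lamR_succ_tower` VERBATIM below the top and the (J-Λ-fold) one storey under the top

WHY (`HOME/b2b-balaban-beta-d1-p3/g40/SPEC-51.md` §F∕§G; an2 g63 J-NOTE-1 l.67433, W-3 l.67480; road g41 l.67484∕86∕92).  The v4 END wrapper
`FP/StepRecursionFeedNestedNamedC.d1Tel_JcComp_ctr_namedC` (p538144) displays, per depth `n` and box, the H-side storey data `cf w κ hb` with the rows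
`hκ : κ k = stepScale 3 Lc (n+1−(k+1))·#B·κ (k+1)` (`k < n+1`), `hκn : κ (n+1) = 1`, `hbl` (linearity), `hbtop : hb (n+1) v = hv v`, `hcf` (summability of the slot
periodisation) and the ladder `hlink` (`k < n+1`): `w k·κ k·(Σ_ā hb k v ā·Σ_μ Σ'_y ĉf_k(μ,y)(ā)·symLinKerAt ρ_c Lc μ y (a.2,a.1)) = w (k+1)·κ (k+1)∕(stepScale 3 Lc (n+1−(k+1))·Lc⁴)·
Σ_ā hb (k+1) v ā·(Σ'_m cf (k+1) a.2 (translate (towerTorus Lc (fine Lc M) k) a.1 m) ā.2 ā.1)`.  With an2 W-3's lower presentation (`cf k := δ`, `hb k :=` the slot weights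
`λ̂′ᴿ_k` read as a bond vector — `FP/TowerHLinkRowsLower`) the left contraction IS `Σ_μ Σ'_y λ̂′ᴿ_k(v)(μ,y)·symLinKerAt … (a.2,a.1)` and the right one IS `λ̂′ᴿ_{k+1}(v)(a.2,a.1)`,
so `hlink` is an2 PART 18 `periodised_lamR_succ_tower` times the scalar identity `w k·κ k = w (k+1)·κ (k+1)∕(stepScale·Lc⁴)` — which the road's `w ∕ κ` satisfy by
construction — and, one storey under the top (`k = n`, where `hb (n+1) = hv` and `cf (n+1) = cfTop`), the (J-Λ-fold) `hfold` (an2 PART 25, displayed) plus the gauge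
part's vanishing (`TowerK1RowTopCoefficients.sum_exact_mul_tsum_cfTop_eq_zero`) under (J-W″) `hJW` (displayed, g39 #5).

WHAT ([folklore] finite-sum ∕ `tsum` bookkeeping BY NAME; no `def`, no `def … : Prop`, nothing cited, 0 sorry; the data enter as binders `κF wF cfF hbF` with DEFINING
EQUATIONS `hκF hwF hcfF hhbF` (so the conclusions are the wrapper's rows verbatim and the (C1) instantiation supplies `fun … => rfl`)):
§1 `tsum_translate_wrap_eq` (period sums are wrap-blind); §2 `hb_top` (`hbtop`), `hb_linear` (`hbl`), `cf_summable` (`hcf`); §3 `lamLow_wrap`, `hlink_left` ∕ `hlink_right` (both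
contractions of `hlink` are `Σ_{a′} v a′·λ̂′ᴿ_{k+1}^{(a′)}(a.2, a.1)` — an2 PART 18 below the top, `hJW ∕ hfold` one storey under the top), **`hlink_row`** (`hlink`; the scalars
`hκ ∕ hκn ∕ w k·κ k`-ladder are `TowerHLinkRowsLower` §4).
WHAT THIS IS NOT: not K1 (`FP/TowerK1RowTopColumn`), not (J-Λ-fold) (an2 PART 25), not `hΛN ∕ hHN₁` (the weight WORD per storey — PART 19 — is the next junction: with these
`w k` the word reads `stepScale²-scalars·w k·r = cΛ (n+2)`-type, c n CANCELS against K1's `w (n+1)` and R-FP-79's pin — SPEC-52); no row discharged AS CONTENT beyond the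
six displayed data rows at the road's data MODULO `hfold ∕ hJW`; 0 estimates; nothing of Bałaban's asserted, valued or discharged; 0∕4 row-D1 binders (hW, hR, D1Tel, D1Rep);
ROOT M‴ p325680 ∕ P5c ∕ D6 untouched; NOT (C1), NOT (L2′), NOT (T-ID), NOT SDF, NOT D1, NEVER «G-an2-4 closed», NOT BetaPertH, NOT continuum, NOT Clay.

HONEST DEPENDENCY (page 1, mandatory): continuum YM on T⁴ ⇐ BetaPertH ∧ nine spine estimates (0/9 proved); BetaPertH ⇐ (D1) ∧ (D4) ∧ CAP+tail;
G-an2-4 gates asym, D1 and NE2/3/4.  HONEST FRAMING (cell contract, verbatim): «discharging `BetaPertH` makes Bałaban's UV stability UNCONDITIONAL —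
a real constructive-QFT result; it is NOT the continuum limit and NOT the Clay problem.»  ABSOLUTE RULE (cell charter, verbatim): «No internally-minted
statement may enter as a cited fact. Every hypothesis is either kernel-proved in this package or a verbatim quotation of a PUBLISHED theorem with page
reference. The manuscript(s) under audit are NOT citable for their own disputed steps — they are the thing under adjudication; programme-internal
(2001/route/tribunal) claims are never citable.»  Road «FP» OWNER, b2b-balaban-beta-d1-p3 gen 41, 2026-08-27.  No existing file touched.
-/

noncomputable section

open scoped BigOperators

namespace Summit.QuantumFields.BalabanUV.Beta.FP.TowerHLinkRows

open Finset
open Literature.MathematicalPhysics.QuantumFieldTheory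
open Literature.MathematicalPhysics.QuantumFieldTheory.Balaban1983to89
open Literature.MathematicalPhysics.QuantumFieldTheory.Balaban1983to89.Beta
open B4TorusKernel.MultiPeriod (translate translate_apply)
open B4Reflection242 (translate_translate)
open B5Prop11Plancherel (fine)
open B6Lemma24Torus (pbox wrap)
open AffineAveraging (Site box toSite)
open AveragingHessianKernels (Bond)
open OneStepResolventKernel (Fib KInv)
open BalabanStepJets (lamCoeffOf)
open Summit.QuantumFields.BalabanUV.Beta.AxialDressingRooted (one_le_of_neZero)
open Summit.QuantumFields.BalabanUV.Beta.CompositeOneShotJetData (Roots AN)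
open Summit.QuantumFields.BalabanUV.Beta.CompositeVertexKernelRec (compLinKer)
open Summit.QuantumFields.BalabanUV.Beta.SymAveragingHessianCounts (symLinKerAt symLinKerAt_eq_zero)
open Summit.QuantumFields.BalabanUV.Beta.BorderedHessian (stepScale)
open Summit.QuantumFields.BalabanUV.Beta.FP.KernelPeriodisationFib (perF)
open Summit.QuantumFields.BalabanUV.Beta.FP.TorusCompositeObjects (towerTorus towerTorus_succ)
open Summit.QuantumFields.BalabanUV.Beta.FP.TorusGaugeCovariance (tgrad)
open Summit.QuantumFields.BalabanUV.Beta.FP.TorusGaugeCovariancePairing (wrapPt wrapPt_coe wrapPt_of_mem)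
open Summit.QuantumFields.BalabanUV.Beta.GAN24.KernelPeriodisation (quo translate_wrap_quo)
open Summit.QuantumFields.BalabanUV.Beta.CoclosedCovectorLinearRowsNear (summable_of_near)
open Summit.QuantumFields.BalabanUV.Beta.NVertexLamCorePeriodised (towerTorus_fine_apply_eq)
open Summit.QuantumFields.BalabanUV.Beta.NVertexLamWeightLadder (periodised_lamR_succ_tower)
open Summit.QuantumFields.BalabanUV.Beta.FP.TowerK1RowTopCoefficients (summable_cfTop_translate sum_exact_mul_tsum_cfTop_eq_zero)
open Summit.QuantumFields.BalabanUV.Beta.FP.TowerHLinkRowsLower (summable_cfDelta_translate sum_hbDelta_mul_tsum_cfDelta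
  sum_hbDelta_mul_sum_tsum_cfDelta_mul_symLinKerAt w_mul_kappa)

variable {Lc : ℕ} [NeZero Lc] (R : Roots Lc) (n : ℕ) (M : Fin (3 + 1) → ℕ) [∀ i, NeZero (M i)]

/-! ## §1 Slot-periodised weights are wrap-blind -/

section Periodic

omit [NeZero Lc] in
/-- [folklore] a period sum is blind to `wrap` (re-index by `quo`; no convergence needed). -/
theorem tsum_translate_wrap_eq (S : Fin (3 + 1) → ℕ) (F : Site (3 + 1) → ℝ) (y : Site (3 + 1)) :
    (∑' m : Site (3 + 1), F (translate S (wrap S y) m)) = ∑' m : Site (3 + 1), F (translate S y m) := by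
  conv_rhs => rw [← translate_wrap_quo S y]
  simp only [translate_translate]
  exact ((Equiv.addLeft (quo S y)).tsum_eq fun m => F (translate S (wrap S y) m)).symm

end Periodic

/-! ## §2 The storey data: `hbtop`, `hbl`, `hcf` -/

section Data

variable {κ : Type*} [Fintype κ] [DecidableEq κ] (yN : κ → Site (3 + 1)) (μN : κ → Fin (3 + 1))
  (hv : (κ → ℝ) → (↥(pbox (towerTorus Lc (fine Lc M) (n + 1))) × Fin (3 + 1) → ℝ))
  (cfF : ℕ → Fin (3 + 1) → Site (3 + 1) → Fin (3 + 1) → Site (3 + 1) → ℝ)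
  (hcfF : ∀ (k : ℕ) (μ : Fin (3 + 1)) (s : Site (3 + 1)) (κ' : Fin (3 + 1)) (x : Site (3 + 1)), cfF k μ s κ' x
    = if k = n + 1 then
        ∑ ν : Fin (3 + 1), ∑' w : Site (3 + 1), lamCoeffOf (KInv (N := Lc ^ (n + 1 + 1)) (d := 3)) (Lc ^ (n + 1 + 1)) ν w κ' x
          * compLinKer (fun _ => symLinKerAt (toSite R.r) Lc) Lc (n + 1) (μ, s) (ν, w)
      else (if x = (Lc : ℤ) • s ∧ κ' = μ then (1 : ℝ) else 0))
  (hbF : (k : ℕ) → (κ → ℝ) → (↥(pbox (towerTorus Lc (fine Lc M) k)) × Fin (3 + 1) → ℝ))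
  (hhbF : ∀ (k : ℕ) (v : κ → ℝ) (ā : ↥(pbox (towerTorus Lc (fine Lc M) k)) × Fin (3 + 1)), hbF k v ā
    = if k = n + 1 then hv v (wrapPt (towerTorus Lc (fine Lc M) (n + 1)) (ā.1 : Site (3 + 1)), ā.2)
      else ∑ y₀ : ↥(pbox (towerTorus Lc M k)), (if (ā.1 : Site (3 + 1)) = (Lc : ℤ) • (y₀ : Site (3 + 1)) then
        ∑ a : κ, v a * ∑' nn : Site (3 + 1), ∑ ν : Fin (3 + 1), ∑' w : Site (3 + 1),
          (∑ κ' : Fin (3 + 1), ∑' u' : Site (3 + 1),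
              AN R (n + 1) u' (((Lc ^ (n + 1 + 1) : ℕ) : ℤ) • yN a) (Sum.inl κ') (Sum.inr (μN a))
                * lamCoeffOf (KInv (N := Lc ^ (n + 1 + 1)) (d := 3)) (Lc ^ (n + 1 + 1)) ν w κ' u')
            * compLinKer (fun _ => symLinKerAt (toSite R.r) Lc) Lc k (ā.2, translate (towerTorus Lc M k) (y₀ : Site (3 + 1)) nn) (ν, w)
        else 0))

omit [DecidableEq κ] in
include hhbF in
/-- [folklore] **`hbtop`**: at the finest level the storey direction IS `hv` (`wrapPt_of_mem`). -/
theorem hb_top (v : κ → ℝ) : hbF (n + 1) v = hv v := by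
  funext ā
  rw [hhbF, if_pos rfl, wrapPt_of_mem]

omit [DecidableEq κ] in
include hhbF in
/-- [folklore] **`hbl`**: every storey direction is linear in the source vector (`hv` is — `hhvl`; below the top the weight is a linear form of `v`). -/
theorem hb_linear (hhvl : ∀ (r : ℝ) (x y : κ → ℝ), hv (r • x + y) = r • hv x + hv y) (k : ℕ) (r : ℝ) (x y : κ → ℝ) :
    hbF k (r • x + y) = r • hbF k x + hbF k y := by
  funext ā
  rw [Pi.add_apply, Pi.smul_apply, smul_eq_mul, hhbF, hhbF, hhbF]
  by_cases hk : k = n + 1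
  · rw [if_pos hk, if_pos hk, if_pos hk, hhvl, Pi.add_apply, Pi.smul_apply, smul_eq_mul]
  · rw [if_neg hk, if_neg hk, if_neg hk, Finset.mul_sum, ← Finset.sum_add_distrib]
    refine Finset.sum_congr rfl fun y₀ _ => ?_
    split_ifs
    · simp only [Pi.add_apply, Pi.smul_apply, smul_eq_mul, add_mul, Finset.sum_add_distrib, mul_assoc, Finset.mul_sum]
    · simp

include hcfF in
/-- [folklore] **`hcf`**: every storey coefficient table has a summable slot periodisation (top: `TowerK1RowTopCoefficients.summable_cfTop_translate`; below: the
δ-table, `TowerHLinkRowsLower.summable_cfDelta_translate`). -/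
theorem cf_summable (k : ℕ) (κ' : Fin (3 + 1)) (u : Site (3 + 1)) (μ : Fin (3 + 1)) (y : Site (3 + 1)) :
    Summable fun m : Site (3 + 1) => cfF k μ (translate (towerTorus Lc M k) y m) κ' u := by
  by_cases hk : k = n + 1
  · subst hk
    simp only [hcfF, if_true]
    exact summable_cfTop_translate R n M μ y κ' u
  · simp only [hcfF, if_neg hk]
    exact summable_cfDelta_translate (towerTorus Lc M k) (towerTorus Lc (fine Lc M) k) (towerTorus_fine_apply_eq M k) μ κ' y u

/-! ## §3 The ladder row `hlink` -/

omit [∀ i, NeZero (M i)] [DecidableEq κ] in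
/-- [folklore] **the slot weight below the top is wrap-blind** (each summand is a period sum over the slot torus). -/
theorem lamLow_wrap (k : ℕ) (v : κ → ℝ) (i : Fin (3 + 1)) (y : Site (3 + 1)) :
    (∑ a : κ, v a * (∑' nn : Site (3 + 1), ∑ ν : Fin (3 + 1), ∑' w : Site (3 + 1),
          (∑ κ' : Fin (3 + 1), ∑' u' : Site (3 + 1),
              AN R (n + 1) u' (((Lc ^ (n + 1 + 1) : ℕ) : ℤ) • yN a) (Sum.inl κ') (Sum.inr (μN a))
                * lamCoeffOf (KInv (N := Lc ^ (n + 1 + 1)) (d := 3)) (Lc ^ (n + 1 + 1)) ν w κ' u')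
            * compLinKer (fun _ => symLinKerAt (toSite R.r) Lc) Lc k (i, translate (towerTorus Lc M k) (wrap (towerTorus Lc M k) y) nn) (ν, w)))
      = ∑ a : κ, v a * (∑' nn : Site (3 + 1), ∑ ν : Fin (3 + 1), ∑' w : Site (3 + 1),
          (∑ κ' : Fin (3 + 1), ∑' u' : Site (3 + 1),
              AN R (n + 1) u' (((Lc ^ (n + 1 + 1) : ℕ) : ℤ) • yN a) (Sum.inl κ') (Sum.inr (μN a))
                * lamCoeffOf (KInv (N := Lc ^ (n + 1 + 1)) (d := 3)) (Lc ^ (n + 1 + 1)) ν w κ' u')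
            * compLinKer (fun _ => symLinKerAt (toSite R.r) Lc) Lc k (i, translate (towerTorus Lc M k) y nn) (ν, w)) :=
  Finset.sum_congr rfl fun a _ => by
    rw [tsum_translate_wrap_eq (towerTorus Lc M k) (fun s => ∑ ν : Fin (3 + 1), ∑' w : Site (3 + 1),
        (∑ κ' : Fin (3 + 1), ∑' u' : Site (3 + 1),
            AN R (n + 1) u' (((Lc ^ (n + 1 + 1) : ℕ) : ℤ) • yN a) (Sum.inl κ') (Sum.inr (μN a))
              * lamCoeffOf (KInv (N := Lc ^ (n + 1 + 1)) (d := 3)) (Lc ^ (n + 1 + 1)) ν w κ' u')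
          * compLinKer (fun _ => symLinKerAt (toSite R.r) Lc) Lc k (i, s) (ν, w)) y]

omit [DecidableEq κ] in
include hhbF hcfF in
/-- [folklore] **`hlink`'s LEFT contraction below the top is an2's next periodised weight**: for `k < n+1`, every `v` and level-`k` bond `a`,
`Σ_ā hb k v ā·Σ_μ Σ'_y ĉf_k(μ,y)(ā)·symLinKerAt (toSite R.r) Lc μ y (a.2,a.1) = Σ_{a′} v a′·λ̂′ᴿ_{k+1}^{(a′)}(a.2, a.1)`
(`TowerHLinkRowsLower.sum_hbDelta_mul_sum_tsum_cfDelta_mul_symLinKerAt`, linearity in the source slots, an2 PART 18 `periodised_lamR_succ_tower` per slot). -/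
theorem hlink_left (v : κ → ℝ) (k : ℕ) (hk : k < n + 1) (a : ↥(pbox (towerTorus Lc (fine Lc M) k)) × Fin (3 + 1)) :
    (∑ ā : ↥(pbox (towerTorus Lc (fine Lc M) k)) × Fin (3 + 1), hbF k v ā *
        ∑ μ : Fin (3 + 1), ∑' y : Site (3 + 1), (∑' m : Site (3 + 1), cfF k μ (translate (towerTorus Lc M k) y m) ā.2 (ā.1 : Site (3 + 1)))
          * symLinKerAt (toSite R.r) Lc μ y (a.2, (a.1 : Site (3 + 1))))
      = ∑ a' : κ, v a' * (∑' nn : Site (3 + 1), ∑ ν : Fin (3 + 1), ∑' w : Site (3 + 1),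
          (∑ κ' : Fin (3 + 1), ∑' u' : Site (3 + 1),
              AN R (n + 1) u' (((Lc ^ (n + 1 + 1) : ℕ) : ℤ) • yN a') (Sum.inl κ') (Sum.inr (μN a'))
                * lamCoeffOf (KInv (N := Lc ^ (n + 1 + 1)) (d := 3)) (Lc ^ (n + 1 + 1)) ν w κ' u')
            * compLinKer (fun _ => symLinKerAt (toSite R.r) Lc) Lc (k + 1) (a.2, translate (towerTorus Lc (fine Lc M) k) (a.1 : Site (3 + 1)) nn) (ν, w)) := by
  have hL : 0 < Lc := Nat.pos_of_ne_zero (NeZero.ne Lc)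
  have hk' : k ≠ n + 1 := Nat.ne_of_lt hk
  simp only [hhbF, hcfF, if_neg hk']
  rw [sum_hbDelta_mul_sum_tsum_cfDelta_mul_symLinKerAt R (towerTorus Lc M k) (towerTorus Lc (fine Lc M) k) (towerTorus_fine_apply_eq M k)
    (fun i y => ∑ a' : κ, v a' * ∑' nn : Site (3 + 1), ∑ ν : Fin (3 + 1), ∑' w : Site (3 + 1),
          (∑ κ' : Fin (3 + 1), ∑' u' : Site (3 + 1),
              AN R (n + 1) u' (((Lc ^ (n + 1 + 1) : ℕ) : ℤ) • yN a') (Sum.inl κ') (Sum.inr (μN a'))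
                * lamCoeffOf (KInv (N := Lc ^ (n + 1 + 1)) (d := 3)) (Lc ^ (n + 1 + 1)) ν w κ' u')
            * compLinKer (fun _ => symLinKerAt (toSite R.r) Lc) Lc k (i, translate (towerTorus Lc M k) y nn) (ν, w))
    (fun i y => lamLow_wrap R n M yN μN k v i y) a]
  have hs : ∀ (μ : Fin (3 + 1)) (c : Site (3 + 1) → ℝ),
      Summable fun y : Site (3 + 1) => c y * symLinKerAt (toSite R.r) Lc μ y (a.2, (a.1 : Site (3 + 1))) :=
    fun μ c => summable_of_near hL (a.1 : Site (3 + 1)) fun y hy => by rw [symLinKerAt_eq_zero R.hr hy, mul_zero]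
  calc ∑ μ : Fin (3 + 1), ∑' y : Site (3 + 1), (∑ a' : κ, v a' * (∑' nn : Site (3 + 1), ∑ ν : Fin (3 + 1), ∑' w : Site (3 + 1),
          (∑ κ' : Fin (3 + 1), ∑' u' : Site (3 + 1),
              AN R (n + 1) u' (((Lc ^ (n + 1 + 1) : ℕ) : ℤ) • yN a') (Sum.inl κ') (Sum.inr (μN a'))
                * lamCoeffOf (KInv (N := Lc ^ (n + 1 + 1)) (d := 3)) (Lc ^ (n + 1 + 1)) ν w κ' u')
            * compLinKer (fun _ => symLinKerAt (toSite R.r) Lc) Lc k (μ, translate (towerTorus Lc M k) y nn) (ν, w)))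
          * symLinKerAt (toSite R.r) Lc μ y (a.2, (a.1 : Site (3 + 1)))
      = ∑ μ : Fin (3 + 1), ∑' y : Site (3 + 1), ∑ a' : κ, v a' * ((∑' nn : Site (3 + 1), ∑ ν : Fin (3 + 1), ∑' w : Site (3 + 1),
          (∑ κ' : Fin (3 + 1), ∑' u' : Site (3 + 1),
              AN R (n + 1) u' (((Lc ^ (n + 1 + 1) : ℕ) : ℤ) • yN a') (Sum.inl κ') (Sum.inr (μN a'))
                * lamCoeffOf (KInv (N := Lc ^ (n + 1 + 1)) (d := 3)) (Lc ^ (n + 1 + 1)) ν w κ' u')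
            * compLinKer (fun _ => symLinKerAt (toSite R.r) Lc) Lc k (μ, translate (towerTorus Lc M k) y nn) (ν, w))
          * symLinKerAt (toSite R.r) Lc μ y (a.2, (a.1 : Site (3 + 1)))) :=
        Finset.sum_congr rfl fun μ _ => tsum_congr fun y => by
          rw [Finset.sum_mul]
          exact Finset.sum_congr rfl fun a' _ => mul_assoc _ _ _
    _ = ∑ μ : Fin (3 + 1), ∑ a' : κ, ∑' y : Site (3 + 1), v a' * ((∑' nn : Site (3 + 1), ∑ ν : Fin (3 + 1), ∑' w : Site (3 + 1),
          (∑ κ' : Fin (3 + 1), ∑' u' : Site (3 + 1),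
              AN R (n + 1) u' (((Lc ^ (n + 1 + 1) : ℕ) : ℤ) • yN a') (Sum.inl κ') (Sum.inr (μN a'))
                * lamCoeffOf (KInv (N := Lc ^ (n + 1 + 1)) (d := 3)) (Lc ^ (n + 1 + 1)) ν w κ' u')
            * compLinKer (fun _ => symLinKerAt (toSite R.r) Lc) Lc k (μ, translate (towerTorus Lc M k) y nn) (ν, w))
          * symLinKerAt (toSite R.r) Lc μ y (a.2, (a.1 : Site (3 + 1)))) :=
        Finset.sum_congr rfl fun μ _ => Summable.tsum_finsetSum fun a' _ => ((hs μ fun y => v a' * (∑' nn : Site (3 + 1), ∑ ν : Fin (3 + 1), ∑' w : Site (3 + 1),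
          (∑ κ' : Fin (3 + 1), ∑' u' : Site (3 + 1),
              AN R (n + 1) u' (((Lc ^ (n + 1 + 1) : ℕ) : ℤ) • yN a') (Sum.inl κ') (Sum.inr (μN a'))
                * lamCoeffOf (KInv (N := Lc ^ (n + 1 + 1)) (d := 3)) (Lc ^ (n + 1 + 1)) ν w κ' u')
            * compLinKer (fun _ => symLinKerAt (toSite R.r) Lc) Lc k (μ, translate (towerTorus Lc M k) y nn) (ν, w))).congr fun y => mul_assoc _ _ _)
    _ = ∑ a' : κ, ∑ μ : Fin (3 + 1), ∑' y : Site (3 + 1), v a' * ((∑' nn : Site (3 + 1), ∑ ν : Fin (3 + 1), ∑' w : Site (3 + 1),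
          (∑ κ' : Fin (3 + 1), ∑' u' : Site (3 + 1),
              AN R (n + 1) u' (((Lc ^ (n + 1 + 1) : ℕ) : ℤ) • yN a') (Sum.inl κ') (Sum.inr (μN a'))
                * lamCoeffOf (KInv (N := Lc ^ (n + 1 + 1)) (d := 3)) (Lc ^ (n + 1 + 1)) ν w κ' u')
            * compLinKer (fun _ => symLinKerAt (toSite R.r) Lc) Lc k (μ, translate (towerTorus Lc M k) y nn) (ν, w))
          * symLinKerAt (toSite R.r) Lc μ y (a.2, (a.1 : Site (3 + 1)))) := Finset.sum_comm
    _ = ∑ a' : κ, v a' * ∑ μ : Fin (3 + 1), ∑' y : Site (3 + 1), (∑' nn : Site (3 + 1), ∑ ν : Fin (3 + 1), ∑' w : Site (3 + 1),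
          (∑ κ' : Fin (3 + 1), ∑' u' : Site (3 + 1),
              AN R (n + 1) u' (((Lc ^ (n + 1 + 1) : ℕ) : ℤ) • yN a') (Sum.inl κ') (Sum.inr (μN a'))
                * lamCoeffOf (KInv (N := Lc ^ (n + 1 + 1)) (d := 3)) (Lc ^ (n + 1 + 1)) ν w κ' u')
            * compLinKer (fun _ => symLinKerAt (toSite R.r) Lc) Lc k (μ, translate (towerTorus Lc M k) y nn) (ν, w))
          * symLinKerAt (toSite R.r) Lc μ y (a.2, (a.1 : Site (3 + 1))) :=
        Finset.sum_congr rfl fun a' _ => by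
          rw [Finset.mul_sum]
          exact Finset.sum_congr rfl fun μ _ => tsum_mul_left
    _ = _ := Finset.sum_congr rfl fun a' _ => by
          rw [periodised_lamR_succ_tower R (n + 1) M k k (μN a') a.2 (yN a') (a.1 : Site (3 + 1))]

include hhbF hcfF in
/-- [folklore] **`hlink`'s RIGHT contraction is an2's next periodised weight too**: for `k < n+1`, every `v` and level-`k` bond `a`,
`Σ_ā hb (k+1) v ā·(Σ'_m cf (k+1) a.2 (translate (towerTorus Lc (fine Lc M) k) a.1 m) ā.2 ā.1) = Σ_{a′} v a′·λ̂′ᴿ_{k+1}^{(a′)}(a.2, a.1)` — below the top by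
`TowerHLinkRowsLower.sum_hbDelta_mul_tsum_cfDelta`; one storey under the top (`k = n`: `hb (n+1) = hv`, `cf (n+1) = cfTop`) by linearity (`hhvl`), (J-W″) `hJW`,
the (J-Λ-fold) `hfold` (an2 PART 25, displayed as in `TowerK1RowTopColumn.K1_row_top`) and `TowerK1RowTopCoefficients.sum_exact_mul_tsum_cfTop_eq_zero`. -/
theorem hlink_right (T' : Fin (3 + 1) → ℕ) (hT' : ∀ i, towerTorus Lc (fine Lc M) (n + 1) i = Lc * T' i)
    (hhvl : ∀ (r : ℝ) (x y : κ → ℝ), hv (r • x + y) = r • hv x + hv y)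
    (lam : κ → ↥(pbox (towerTorus Lc (fine Lc M) (n + 1))) → ℝ)
    (hJW : ∀ (a : κ) (b : ↥(pbox (towerTorus Lc (fine Lc M) (n + 1))) × Fin (3 + 1)), hv (Pi.single a 1) b
        = perF (towerTorus Lc (fine Lc M) (n + 1)) (AN R (n + 1)) (b.1, Sum.inl b.2)
            (wrapPt (towerTorus Lc (fine Lc M) (n + 1)) (((Lc ^ (n + 1 + 1) : ℕ) : ℤ) • yN a), Sum.inr (μN a))
          - ∑ s : ↥(pbox (towerTorus Lc (fine Lc M) (n + 1))), tgrad (towerTorus Lc (fine Lc M) (n + 1)) (b.1, Sum.inl b.2) s * lam a s)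
    (hfold : ∀ (μ : Fin (3 + 1)) (y : Site (3 + 1)) (κ₁ : Fin (3 + 1)) (s₁ : Site (3 + 1)),
        ∑ ā : ↥(pbox (towerTorus Lc (fine Lc M) (n + 1))) × Fin (3 + 1),
            perF (towerTorus Lc (fine Lc M) (n + 1)) (AN R (n + 1)) (ā.1, Sum.inl ā.2)
                (wrapPt (towerTorus Lc (fine Lc M) (n + 1)) (((Lc ^ (n + 1 + 1) : ℕ) : ℤ) • y), Sum.inr μ)
              * (∑' m : Site (3 + 1), ∑ ν : Fin (3 + 1), ∑' w : Site (3 + 1),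
                  lamCoeffOf (KInv (N := Lc ^ (n + 1 + 1)) (d := 3)) (Lc ^ (n + 1 + 1)) ν w ā.2 (ā.1 : Site (3 + 1))
                    * compLinKer (fun _ => symLinKerAt (toSite R.r) Lc) Lc (n + 1) (κ₁, translate T' s₁ m) (ν, w))
          = ∑' m : Site (3 + 1), ∑ ν : Fin (3 + 1), ∑' w : Site (3 + 1),
              (∑ κ' : Fin (3 + 1), ∑' u' : Site (3 + 1),
                  AN R (n + 1) u' (((Lc ^ (n + 1 + 1) : ℕ) : ℤ) • y) (Sum.inl κ') (Sum.inr μ)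
                    * lamCoeffOf (KInv (N := Lc ^ (n + 1 + 1)) (d := 3)) (Lc ^ (n + 1 + 1)) ν w κ' u')
                * compLinKer (fun _ => symLinKerAt (toSite R.r) Lc) Lc (n + 1) (κ₁, translate T' s₁ m) (ν, w))
    (v : κ → ℝ) (k : ℕ) (hk : k < n + 1) (a : ↥(pbox (towerTorus Lc (fine Lc M) k)) × Fin (3 + 1)) :
    (∑ ā : ↥(pbox (towerTorus Lc (fine Lc M) (k + 1))) × Fin (3 + 1), hbF (k + 1) v ā *
        ∑' m : Site (3 + 1), cfF (k + 1) a.2 (translate (towerTorus Lc (fine Lc M) k) (a.1 : Site (3 + 1)) m) ā.2 (ā.1 : Site (3 + 1)))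
      = ∑ a' : κ, v a' * (∑' nn : Site (3 + 1), ∑ ν : Fin (3 + 1), ∑' w : Site (3 + 1),
          (∑ κ' : Fin (3 + 1), ∑' u' : Site (3 + 1),
              AN R (n + 1) u' (((Lc ^ (n + 1 + 1) : ℕ) : ℤ) • yN a') (Sum.inl κ') (Sum.inr (μN a'))
                * lamCoeffOf (KInv (N := Lc ^ (n + 1 + 1)) (d := 3)) (Lc ^ (n + 1 + 1)) ν w κ' u')
            * compLinKer (fun _ => symLinKerAt (toSite R.r) Lc) Lc (k + 1) (a.2, translate (towerTorus Lc (fine Lc M) k) (a.1 : Site (3 + 1)) nn) (ν, w)) := by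
  have hL : 0 < Lc := Nat.pos_of_ne_zero (NeZero.ne Lc)
  by_cases hkn : k + 1 = n + 1
  · -- ONE STOREY UNDER THE TOP: `hb (n+1) = hv`, `cf (n+1) = cfTop`
    have hkn' : k = n := Nat.succ_injective hkn
    subst hkn'
    have hT'eq : T' = towerTorus Lc (fine Lc M) k := by
      funext i
      have h := hT' i
      rw [towerTorus_fine_apply_eq M (k + 1) i] at h
      exact (Nat.eq_of_mul_eq_mul_left hL h).symm
    subst hT'eq
    simp only [hhbF, hcfF, if_true, wrapPt_of_mem, Prod.mk.eta]
    -- linearity in `v`: read the contraction off the basis slots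
    have hlin : ∀ (r : ℝ) (x y : κ → ℝ),
        (∑ ā : ↥(pbox (towerTorus Lc (fine Lc M) (k + 1))) × Fin (3 + 1), hv (r • x + y) ā *
          ∑' m : Site (3 + 1), ∑ ν : Fin (3 + 1), ∑' w : Site (3 + 1),
            lamCoeffOf (KInv (N := Lc ^ (k + 1 + 1)) (d := 3)) (Lc ^ (k + 1 + 1)) ν w ā.2 (ā.1 : Site (3 + 1))
              * compLinKer (fun _ => symLinKerAt (toSite R.r) Lc) Lc (k + 1)
                  (a.2, translate (towerTorus Lc (fine Lc M) k) (a.1 : Site (3 + 1)) m) (ν, w))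
          = r * (∑ ā : ↥(pbox (towerTorus Lc (fine Lc M) (k + 1))) × Fin (3 + 1), hv x ā *
          ∑' m : Site (3 + 1), ∑ ν : Fin (3 + 1), ∑' w : Site (3 + 1),
            lamCoeffOf (KInv (N := Lc ^ (k + 1 + 1)) (d := 3)) (Lc ^ (k + 1 + 1)) ν w ā.2 (ā.1 : Site (3 + 1))
              * compLinKer (fun _ => symLinKerAt (toSite R.r) Lc) Lc (k + 1)
                  (a.2, translate (towerTorus Lc (fine Lc M) k) (a.1 : Site (3 + 1)) m) (ν, w))
          + ∑ ā : ↥(pbox (towerTorus Lc (fine Lc M) (k + 1))) × Fin (3 + 1), hv y ā *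
          ∑' m : Site (3 + 1), ∑ ν : Fin (3 + 1), ∑' w : Site (3 + 1),
            lamCoeffOf (KInv (N := Lc ^ (k + 1 + 1)) (d := 3)) (Lc ^ (k + 1 + 1)) ν w ā.2 (ā.1 : Site (3 + 1))
              * compLinKer (fun _ => symLinKerAt (toSite R.r) Lc) Lc (k + 1)
                  (a.2, translate (towerTorus Lc (fine Lc M) k) (a.1 : Site (3 + 1)) m) (ν, w) := by
      intro r x y
      rw [hhvl]
      simp only [Pi.add_apply, Pi.smul_apply, smul_eq_mul, add_mul, Finset.sum_add_distrib, mul_assoc, ← Finset.mul_sum]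
    rw [TowerK1RowTopCoefficients.apply_eq_sum_mul_single_of_linear (fun x : κ → ℝ =>
        ∑ ā : ↥(pbox (towerTorus Lc (fine Lc M) (k + 1))) × Fin (3 + 1), hv x ā *
          ∑' m : Site (3 + 1), ∑ ν : Fin (3 + 1), ∑' w : Site (3 + 1),
            lamCoeffOf (KInv (N := Lc ^ (k + 1 + 1)) (d := 3)) (Lc ^ (k + 1 + 1)) ν w ā.2 (ā.1 : Site (3 + 1))
              * compLinKer (fun _ => symLinKerAt (toSite R.r) Lc) Lc (k + 1)
                  (a.2, translate (towerTorus Lc (fine Lc M) k) (a.1 : Site (3 + 1)) m) (ν, w)) hlin v]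
    refine Finset.sum_congr rfl fun a' _ => ?_
    congr 1
    have hva : ∀ ā : ↥(pbox (towerTorus Lc (fine Lc M) (k + 1))) × Fin (3 + 1), hv (Pi.single a' 1) ā
        = perF (towerTorus Lc (fine Lc M) (k + 1)) (AN R (k + 1)) (ā.1, Sum.inl ā.2)
            (wrapPt (towerTorus Lc (fine Lc M) (k + 1)) (((Lc ^ (k + 1 + 1) : ℕ) : ℤ) • yN a'), Sum.inr (μN a'))
          - ∑ s : ↥(pbox (towerTorus Lc (fine Lc M) (k + 1))), tgrad (towerTorus Lc (fine Lc M) (k + 1)) (ā.1, Sum.inl ā.2) s * lam a' s :=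
      fun ā => hJW a' ā
    simp only [hva, sub_mul, Finset.sum_sub_distrib]
    have e2 := sum_exact_mul_tsum_cfTop_eq_zero R k M a.2 (a.1 : Site (3 + 1)) (lam a')
    rw [show towerTorus Lc M (k + 1) = towerTorus Lc (fine Lc M) k from rfl] at e2
    rw [hfold (μN a') (yN a') a.2 (a.1 : Site (3 + 1)), e2, sub_zero]
  · -- BELOW: the δ-table and the root-bond embedding one level down
    have hk1 : k + 1 ≠ n + 1 := hkn
    simp only [hhbF, hcfF, if_neg hk1]
    exact sum_hbDelta_mul_tsum_cfDelta (towerTorus Lc M (k + 1)) (towerTorus Lc (fine Lc M) (k + 1)) (towerTorus_fine_apply_eq M (k + 1))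
      (fun i y => ∑ a' : κ, v a' * (∑' nn : Site (3 + 1), ∑ ν : Fin (3 + 1), ∑' w : Site (3 + 1),
          (∑ κ' : Fin (3 + 1), ∑' u' : Site (3 + 1),
              AN R (n + 1) u' (((Lc ^ (n + 1 + 1) : ℕ) : ℤ) • yN a') (Sum.inl κ') (Sum.inr (μN a'))
                * lamCoeffOf (KInv (N := Lc ^ (n + 1 + 1)) (d := 3)) (Lc ^ (n + 1 + 1)) ν w κ' u')
            * compLinKer (fun _ => symLinKerAt (toSite R.r) Lc) Lc (k + 1) (i, translate (towerTorus Lc M (k + 1)) y nn) (ν, w)))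
      (fun i y => lamLow_wrap R n M yN μN (k + 1) v i y) a.2 (a.1 : Site (3 + 1))

include hhbF hcfF in
/-- [folklore] **`hlink_row` — THE END WRAPPER's LADDER ROW `hlink` DISCHARGED FOR THE ROAD's STOREY DATA** (modulo the displayed `hJW` ∕ `hfold`, which enter only one storey
under the top): for every `v`, every `k < n+1` and every level-`k` bond `a`,
`w k·κ k·(Σ_ā hb k v ā·Σ_μ Σ'_y (Σ'_m cf k μ (translate (towerTorus Lc M k) y m) ā.2 ā.1)·symLinKerAt (toSite R.r) Lc μ y (a.2, a.1))
 = w (k+1)·κ (k+1) ∕ (stepScale 3 Lc (n+1−(k+1))·Lc⁴)·Σ_ā hb (k+1) v ā·(Σ'_m cf (k+1) a.2 (translate (towerTorus Lc (fine Lc M) k) a.1 m) ā.2 ā.1)`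
— the wrapper's `hlink n B v k hk a` at `Mc B := M`, `Ma n B k := towerTorus Lc M k` (`hMa` = `towerTorus_fine_apply_eq`), `R := Roots.ctr Lc` (`toSite R.r ≡ toSite (ctrOff 4 Lc)`).
Both contractions are `Σ_{a′} v a′·λ̂′ᴿ_{k+1}^{(a′)}(a.2, a.1)` (`hlink_left`, `hlink_right`); the scalars by `w_mul_kappa`. -/
theorem hlink_row (c : ℝ) (κF wF : ℕ → ℝ)
    (hκF : ∀ k, κF k = ∏ i ∈ Finset.Ico k (n + 1), (stepScale 3 Lc (n + 1 - (i + 1)) * ((box (3 + 1) Lc).card : ℝ)))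
    (hwF : ∀ k, wF k = (-(c * ((Lc : ℝ) ^ (3 + 1)) ^ (n + 1 + 1))
        / ∏ i ∈ Finset.Ico k (n + 1), (stepScale 3 Lc (n + 1 - (i + 1)) * (Lc : ℝ) ^ (3 + 1))) / κF k)
    (T' : Fin (3 + 1) → ℕ) (hT' : ∀ i, towerTorus Lc (fine Lc M) (n + 1) i = Lc * T' i)
    (hhvl : ∀ (r : ℝ) (x y : κ → ℝ), hv (r • x + y) = r • hv x + hv y)
    (lam : κ → ↥(pbox (towerTorus Lc (fine Lc M) (n + 1))) → ℝ)
    (hJW : ∀ (a : κ) (b : ↥(pbox (towerTorus Lc (fine Lc M) (n + 1))) × Fin (3 + 1)), hv (Pi.single a 1) b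
        = perF (towerTorus Lc (fine Lc M) (n + 1)) (AN R (n + 1)) (b.1, Sum.inl b.2)
            (wrapPt (towerTorus Lc (fine Lc M) (n + 1)) (((Lc ^ (n + 1 + 1) : ℕ) : ℤ) • yN a), Sum.inr (μN a))
          - ∑ s : ↥(pbox (towerTorus Lc (fine Lc M) (n + 1))), tgrad (towerTorus Lc (fine Lc M) (n + 1)) (b.1, Sum.inl b.2) s * lam a s)
    (hfold : ∀ (μ : Fin (3 + 1)) (y : Site (3 + 1)) (κ₁ : Fin (3 + 1)) (s₁ : Site (3 + 1)),
        ∑ ā : ↥(pbox (towerTorus Lc (fine Lc M) (n + 1))) × Fin (3 + 1),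
            perF (towerTorus Lc (fine Lc M) (n + 1)) (AN R (n + 1)) (ā.1, Sum.inl ā.2)
                (wrapPt (towerTorus Lc (fine Lc M) (n + 1)) (((Lc ^ (n + 1 + 1) : ℕ) : ℤ) • y), Sum.inr μ)
              * (∑' m : Site (3 + 1), ∑ ν : Fin (3 + 1), ∑' w : Site (3 + 1),
                  lamCoeffOf (KInv (N := Lc ^ (n + 1 + 1)) (d := 3)) (Lc ^ (n + 1 + 1)) ν w ā.2 (ā.1 : Site (3 + 1))
                    * compLinKer (fun _ => symLinKerAt (toSite R.r) Lc) Lc (n + 1) (κ₁, translate T' s₁ m) (ν, w))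
          = ∑' m : Site (3 + 1), ∑ ν : Fin (3 + 1), ∑' w : Site (3 + 1),
              (∑ κ' : Fin (3 + 1), ∑' u' : Site (3 + 1),
                  AN R (n + 1) u' (((Lc ^ (n + 1 + 1) : ℕ) : ℤ) • y) (Sum.inl κ') (Sum.inr μ)
                    * lamCoeffOf (KInv (N := Lc ^ (n + 1 + 1)) (d := 3)) (Lc ^ (n + 1 + 1)) ν w κ' u')
                * compLinKer (fun _ => symLinKerAt (toSite R.r) Lc) Lc (n + 1) (κ₁, translate T' s₁ m) (ν, w))
    (v : κ → ℝ) (k : ℕ) (hk : k < n + 1) (a : ↥(pbox (towerTorus Lc (fine Lc M) k)) × Fin (3 + 1)) :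
    wF k * κF k * (∑ ā : ↥(pbox (towerTorus Lc (fine Lc M) k)) × Fin (3 + 1), hbF k v ā *
        ∑ μ : Fin (3 + 1), ∑' y : Site (3 + 1), (∑' m : Site (3 + 1), cfF k μ (translate (towerTorus Lc M k) y m) ā.2 (ā.1 : Site (3 + 1)))
          * symLinKerAt (toSite R.r) Lc μ y (a.2, (a.1 : Site (3 + 1))))
      = wF (k + 1) * κF (k + 1) / (stepScale 3 Lc (n + 1 - (k + 1)) * (Lc : ℝ) ^ (3 + 1)) *
        ∑ ā : ↥(pbox (towerTorus Lc (fine Lc M) (k + 1))) × Fin (3 + 1), hbF (k + 1) v ā *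
          ∑' m : Site (3 + 1), cfF (k + 1) a.2 (translate (towerTorus Lc (fine Lc M) k) (a.1 : Site (3 + 1)) m) ā.2 (ā.1 : Site (3 + 1)) := by
  rw [hlink_left R n M yN μN hv cfF hcfF hbF hhbF v k hk a,
    hlink_right R n M yN μN hv cfF hcfF hbF hhbF T' hT' hhvl lam hJW hfold v k hk a,
    w_mul_kappa n c κF wF hκF hwF k hk]

end Data

end Summit.QuantumFields.BalabanUV.Beta.FP.TowerHLinkRows

end
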